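import Summits.SmoothPoincare4.SmoothPoincare4.Theorems.SullivanDualWitnessChargeReductionV18

/-!
# Route item `Assembly2` (stmt-SmoothPoincare4-18038), closed

The glue item `Theses.SullivanDual.Assembly2 :
LocalFoliationEmbeddedSpheres → NormalWitnessTransfer → PencilLocalFamily` (route-choice
rchoice-7e333091: the v16 assembly of crux `WitnessCharge` re-routed around the `J`-curve half of
adjunction, keeping only the normal-witness transfer) is exactly `helper_pencilLocalFamily_of_hls_nwt`
(line `Sketch`, reduction v18).
-/

set_option linter.dupNamespace false

namespace Summit.SmoothPoincare4.SmoothPoincare4.Theorems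

/-- **Route item `Assembly2` (stmt-SmoothPoincare4-18038).** -/
theorem SullivanDual_Assembly2_proof :
    Summit.SmoothPoincare4.SmoothPoincare4.Theses.SullivanDual.Assembly2 :=
  fun hL hN => WitnessCharge.PencilIncompleteness.helper_pencilLocalFamily_of_hls_nwt hL hN

end Summit.SmoothPoincare4.SmoothPoincare4.Theorems
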